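import Literature.NumberTheory.Rogawski1990.FinExplicitTransferFactor
import Literature.NumberTheory.Rogawski1990.ArchExplicitTransferFactor
import Literature.NumberTheory.Rogawski1990.AdelicStableConjugacy
import HarnessLib

/-!
# Rogawski's explicit transfer factors at a RATIONAL pair: every ingredient of `Δ‴_v(γ_H, γ)` and of `Δ″_∞(γ_H, γ)` is the image of ONE global quantity
# under `L → ∏_{w∣v} L_w` resp. `L → L ⊗ ℝ` (node (R) «rational-pair localisation» of DESK TABLE #3, the shared plumbing of N3 ∕ N4 ∕ N5 of `F0/P3a/T6b-TREE.md` §9)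

Topic `NumberTheory/Rogawski1990`; namespace `Literature.NumberTheory.Rogawski1990`.  THEOREMS ONLY (no definition, no named fact, no instance, no notation, no `sorry`).
Cell `pub/hodgecm-mathlib`, floor 0, F0∕P3a, crux H413, typer topic T6 (#72 side).  For a RATIONAL `γ_H = (g, u) ∈ H(L⁺) = U(Φ₂)(L⁺) × U(Φ₁)(L⁺)` and a rational
`γ ∈ G′(L⁺) = U(H′)(L⁺)`, the local pair at a finite place `v` is ★ `rationalComponent L γ_H v` (= `toLocal v ∘ toAdelic` componentwise) with
`(toLocal v (toAdelic γ)).val.val = γ.val.val` pushed along `algebraMap L (∏_{w∣v} L_w)` (definitional, ★ `adeleToLocal_algebraMap`), and the archimedean pair is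
★ `rationalArch L γ_H`, ★ `cmRationalToArch L 3 H′ γ` (entrywise `mixedEmbedding L`, ★ `coe_rationalToArch`).  This file records, ingredient by ingredient, that the
data of ★ `FinExplicitTransferFactor` (p827456) and ★ `ArchExplicitTransferFactor` (p826337) at such a pair are the images of GLOBAL elements of `L`:
`u`, `χ_g ∈ L[X]`, `det g⁻¹`, `−χ_g(u)·det g⁻¹`, the projector `P = γ² − tr g·γ + det g·1 ∈ M₃(L)`, the column form values `x_j = p_jᴴ H′ p_j ∈ L` and the relative
position `x_{j₀}` (the SAME first non-zero column index at every place, by injectivity of the embeddings) — so that the reciprocity laws of `L` (Hecke characters on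
principal idèles, the product formula, Hilbert reciprocity) can be applied to `Π_v Δ‴_v · Δ‴_∞` term by term (nodes N3 a.e.-triviality, N4 product formula, N5 (4.3.3)).
Print: «By a global property of transfer factors (cf. §4.9), `Π_v Δ′_v(γ, i(γ)) = 1`» (§14.6 p. 242) — the global property being that every local ingredient is read off
the rational pair [Rogawski1990 §4.9 p. 55: `τ(γ) = μ(γ₂)μ⁻¹((γ₂γ₁⁻¹ − 1)(1 − γ₂γ₃⁻¹))`, `D_{G∕H} = |…|^{1∕2}`, `κ`]; [LanglandsShelstad1987 §6.3–6.4]: the global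
hypothesis «`γ_H`, `γ_G` rational» under which `Π_v Δ_v = 1`.

* §0 coordinates: `algebraMap L (∏_{w∣v} L_w)` componentwise, its injectivity, its compatibility with `c ⊗ 1` (★ `adeleToLocal_conj`, ★ `algebraMap_conj`), the local
  form `(H′ ⊗ 1)_v = H′.map (algebraMap …)`; the matrices of `rationalComponent` ∕ `toLocal ∘ toAdelic` ∕ `cmRationalToArch` (all `rfl`).
* §1 finite place, `γ_H` rational: `finGammaTwo ∕ finCharpolyTwo ∕ finDetInvFst ∕ finTauArg ∕ finTau ∕ finWeylRatio` at `rationalComponent L γ_H v`.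
* §2 finite place, the pair: `finEigenlineProjector` for rational `γ_H` and ANY local `b` (the N3∕N5 shape, `b = γ̄_v` adelic) and for a rational `γ`
  (`= P.map (algebraMap …)`); `finColumnFormValue`, `finRelPos`, `finKappaAt` at a rational pair.
* §3 archimedean: `archGammaTwo ∕ archCharpolyTwo ∕ archTauArg ∕ archTau ∕ archWeylRatio` at `rationalArch L γ_H`; `archEigenlineProjector … w (cmRationalToArch L 3 H′ γ)
  = P.map w.embedding`, hence `archKappaAt` at a rational pair reads only `σ_w(P)`.
The matching clause itself localises by ★ `isLocalNormPair_rationalComponent_toLocal_toAdelic` ∕ ★ `isArchNormPair_rationalArch_cmRationalToArch` (`AdelicStableClassesProductGp`,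
not imported here to keep the import closure light), after which ★ `finExplicitDelta_of_isLocalNormPair` ∕ ★ `archExplicitDelta_of_isArchNormPair` unfold the factors.
HONEST LABEL: HC_CM is proved only modulo the printed citations until rung 0 closes; this file is bookkeeping (no reciprocity law is proved here).

## References
* [Rogawski1990] J. D. Rogawski, *Automorphic Representations of Unitary Groups in Three Variables*, Ann. of Math. Stud. 123 (1990), §4.3 pp. 43–44 ((4.3.3)), §4.9
  p. 55 (`τ`, `D_{G∕H}`, `κ`), §14.6 p. 242 («`Π_v Δ′_v(γ, i(γ)) = 1`»).
* [LanglandsShelstad1987] R. P. Langlands, D. Shelstad, *On the definition of transfer factors*, Math. Ann. 278 (1987), §6.3–6.4 (global hypothesis, product formula).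
-/

set_option autoImplicit false

noncomputable section

open NumberField IsDedekindDomain Matrix Polynomial
open Literature.NumberTheory.GaloisRepresentations
open scoped MatrixGroups

namespace Literature.NumberTheory.Rogawski1990

open Literature.NumberTheory.Automorphic

/-! ## §0 Coordinates of the diagonal embeddings -/

/-- The determinant of a pushed-forward matrix (Mathlib `RingHom.map_det`, bookkeeping). [folklore] -/
private theorem det_map_ringHom {R S : Type*} [CommRing R] [CommRing S] (f : R →+* S) {n : ℕ} (M : Matrix (Fin n) (Fin n) R) :
    (M.map f).det = f M.det := by
  rw [RingHom.map_det, RingHom.mapMatrix_apply]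

/-- The trace of a pushed-forward matrix (bookkeeping). [folklore] -/
private theorem trace_map_ringHom {R S : Type*} [CommRing R] [CommRing S] (f : R →+* S) {n : ℕ} (M : Matrix (Fin n) (Fin n) R) :
    (M.map f).trace = f M.trace := by
  simp only [Matrix.trace, Matrix.diag_apply, Matrix.map_apply, map_sum]

/-- The projector polynomial `X² − t·X + d·1` commutes with pushing forward along a ring homomorphism (bookkeeping). [folklore] -/
private theorem map_projector {R S : Type*} [CommRing R] [CommRing S] (f : R →+* S) (X : Matrix (Fin 3) (Fin 3) R) (t d : R) :
    (X * X - t • X + d • (1 : Matrix (Fin 3) (Fin 3) R)).map f = X.map f * X.map f - f t • X.map f + f d • (1 : Matrix (Fin 3) (Fin 3) S) := by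
  ext i j
  simp only [Matrix.map_apply, Matrix.add_apply, Matrix.sub_apply, Matrix.smul_apply, Matrix.mul_apply, Matrix.one_apply, smul_eq_mul,
    map_add, map_sub, map_mul, map_sum]
  split_ifs <;> simp

variable (L : Type) [Field L] [NumberField L] (v : HeightOneSpectrum (𝓞 ↥(maximalRealSubfield L)))


/-- `(a ⊗ 1)_w = a` in `L_w`: the `w`-coordinate of `algebraMap L (∏_{w∣v} L_w)` is the embedding `L → L_w` (definitional; `L ⊗_{L⁺} L⁺_v = ∏_{w∣v} L_w`). [cite: CasselsFrohlichANT1967, Ch. II §10–§11] -/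
theorem algebraMap_localRing_apply (a : L) (w : UnitaryGroup.PlacesOver L v) :
    algebraMap L (UnitaryGroup.LocalRing L v) a w = algebraMap L (w.1.adicCompletion L) a := rfl

/-- `L → 𝔸_L → ∏_{w∣v} L_w` is `algebraMap L (∏_{w∣v} L_w)` (★ `adeleToLocal_algebraMap`, definitional). [cite: CasselsFrohlichANT1967, Ch. II §10–§11] -/
theorem adeleToLocal_comp_algebraMap :
    (UnitaryGroup.adeleToLocal L v).comp (algebraMap L (AdeleRing (𝓞 L) L)) = algebraMap L (UnitaryGroup.LocalRing L v) := rfl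

/-- **`L → ∏_{w∣v} L_w` is injective** (there is a place `w ∣ v`, and `L → L_w` is a field embedding). [cite: CasselsFrohlichANT1967, Ch. II §10–§11] -/
theorem algebraMap_localRing_injective : Function.Injective (algebraMap L (UnitaryGroup.LocalRing L v)) := by
  intro a b h
  obtain ⟨w⟩ := (inferInstance : Nonempty (UnitaryGroup.PlacesOver L v))
  have hw := congrFun h w
  rw [algebraMap_localRing_apply, algebraMap_localRing_apply] at hw
  exact (algebraMap L (w.1.adicCompletion L)).injective hw

variable [IsCMField L]

/-- **`(c ⊗ 1)(a ⊗ 1) = (c a) ⊗ 1` in `∏_{w∣v} L_w`** (★ `adeleToLocal_conj` + ★ `algebraMap_conj`: the Galois action on `L ⊗ L⁺_v` is `c ⊗ 1`). [cite: CasselsFrohlichANT1967, Ch. VII §1.1] -/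
theorem conjLocal_algebraMap (a : L) :
    UnitaryGroup.conjLocal L (IsCMField.complexConj L) v (algebraMap L (UnitaryGroup.LocalRing L v) a) =
      algebraMap L (UnitaryGroup.LocalRing L v) (IsCMField.complexConj L a) := by
  rw [← UnitaryGroup.adeleToLocal_algebraMap, ← UnitaryGroup.adeleToLocal_conj, ← UnitaryGroup.algebraMap_conj,
    UnitaryGroup.adeleToLocal_algebraMap]
  rfl

omit [IsCMField L] in
/-- **The local form matrix is the rational one pushed to `∏_{w∣v} L_w`**: `(H ⊗ 1)_v = H.map (algebraMap …)`. [cite: CasselsFrohlichANT1967, Ch. II §10–§11] [cite: Rogawski1990, §4.9 p. 54] -/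
theorem adelicForm_map_adeleToLocal {N : ℕ} (H : Matrix (Fin N) (Fin N) L) :
    (UnitaryGroup.adelicForm L N H).map (UnitaryGroup.adeleToLocal L v) = H.map (algebraMap L (UnitaryGroup.LocalRing L v)) := by
  rw [UnitaryGroup.adelicForm, Matrix.map_map]
  rfl

/-- The matrix of `(γ)_v = toLocal v (toAdelic γ)` is `γ` pushed along `algebraMap L (∏_{w∣v} L_w)` (definitional). [cite: CasselsFrohlichANT1967, Ch. II §10–§11] [cite: BorelJacquet1979, §4.1] -/
theorem coe_coe_toLocal_toAdelic {N : ℕ} (H : Matrix (Fin N) (Fin N) L) (γ : (UnitaryGroup.cmDatum L N H).Rational) :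
    (((UnitaryGroup.cmDatum L N H).toLocal v ((UnitaryGroup.cmDatum L N H).toAdelic γ)).val.val :
        Matrix (Fin N) (Fin N) (UnitaryGroup.LocalRing L v)) =
      (γ.val.val : Matrix (Fin N) (Fin N) L).map (algebraMap L (UnitaryGroup.LocalRing L v)) := by
  have e : (((UnitaryGroup.cmDatum L N H).toLocal v ((UnitaryGroup.cmDatum L N H).toAdelic γ)).val.val :
        Matrix (Fin N) (Fin N) (UnitaryGroup.LocalRing L v)) =
      ((γ.val.val : Matrix (Fin N) (Fin N) L).map (algebraMap L (AdeleRing (𝓞 L) L))).map (UnitaryGroup.adeleToLocal L v) := rfl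
  rw [e, Matrix.map_map]
  rfl

/-- The matrix of the inverse `(γ)_v⁻¹` is `γ⁻¹` pushed along `algebraMap L (∏_{w∣v} L_w)`. [cite: CasselsFrohlichANT1967, Ch. II §10–§11] [cite: BorelJacquet1979, §4.1] -/
theorem coe_inv_toLocal_toAdelic {N : ℕ} (H : Matrix (Fin N) (Fin N) L) (γ : (UnitaryGroup.cmDatum L N H).Rational) :
    ((((UnitaryGroup.cmDatum L N H).toLocal v ((UnitaryGroup.cmDatum L N H).toAdelic γ)).val⁻¹).val :
        Matrix (Fin N) (Fin N) (UnitaryGroup.LocalRing L v)) =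
      ((γ.val⁻¹).val : Matrix (Fin N) (Fin N) L).map (algebraMap L (UnitaryGroup.LocalRing L v)) := by
  have h : ((UnitaryGroup.cmDatum L N H).toLocal v ((UnitaryGroup.cmDatum L N H).toAdelic γ)).val⁻¹ =
      ((UnitaryGroup.cmDatum L N H).toLocal v ((UnitaryGroup.cmDatum L N H).toAdelic γ⁻¹)).val := by
    rw [map_inv, map_inv]
    rfl
  have h' : (γ.val⁻¹ : GL (Fin N) L) = (γ⁻¹).val := rfl
  rw [h, h']
  exact coe_coe_toLocal_toAdelic L v H γ⁻¹

/-- The matrix of `γ ⊗ 1 = cmRationalToArch γ` is `γ` pushed along `mixedEmbedding L` (definitional, ★ `coe_rationalToArch`). [cite: BorelJacquet1979, §4.1] -/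
theorem coe_coe_cmRationalToArch {N : ℕ} (H : Matrix (Fin N) (Fin N) L) (γ : (UnitaryGroup.cmDatum L N H).Rational) :
    (((cmRationalToArch L N H γ : ↥(UnitaryGroup.arch (↥(maximalRealSubfield L)) L (IsCMField.complexConj L) N H)) :
          GL (Fin N) (mixedEmbedding.mixedSpace L)) : Matrix (Fin N) (Fin N) (mixedEmbedding.mixedSpace L)) =
      (γ.val.val : Matrix (Fin N) (Fin N) L).map (mixedEmbedding L) := rfl

/-- The matrix of `(γ ⊗ 1)⁻¹` is `γ⁻¹` pushed along `mixedEmbedding L`. [cite: BorelJacquet1979, §4.1] -/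
theorem coe_inv_cmRationalToArch {N : ℕ} (H : Matrix (Fin N) (Fin N) L) (γ : (UnitaryGroup.cmDatum L N H).Rational) :
    ((((cmRationalToArch L N H γ : ↥(UnitaryGroup.arch (↥(maximalRealSubfield L)) L (IsCMField.complexConj L) N H)) :
          GL (Fin N) (mixedEmbedding.mixedSpace L))⁻¹ : GL (Fin N) (mixedEmbedding.mixedSpace L)) :
        Matrix (Fin N) (Fin N) (mixedEmbedding.mixedSpace L)) =
      ((γ.val⁻¹ : GL (Fin N) L) : Matrix (Fin N) (Fin N) L).map (mixedEmbedding L) := by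
  have h : (((cmRationalToArch L N H γ : ↥(UnitaryGroup.arch (↥(maximalRealSubfield L)) L (IsCMField.complexConj L) N H)) :
        GL (Fin N) (mixedEmbedding.mixedSpace L))⁻¹ : GL (Fin N) (mixedEmbedding.mixedSpace L)) =
      ((cmRationalToArch L N H γ⁻¹ : ↥(UnitaryGroup.arch (↥(maximalRealSubfield L)) L (IsCMField.complexConj L) N H)) :
        GL (Fin N) (mixedEmbedding.mixedSpace L)) := by
    rw [map_inv]
    rfl
  rw [h, coe_coe_cmRationalToArch]
  rfl


/-! ## §1 Finite place, `γ_H` rational: `u`, `χ_g`, `det g⁻¹`, `τ_v`, `D_{G∕H,v}` are images of global elements -/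

section FinH

variable (γH : (UnitaryGroup.cmDatum L 2 (Matrix.of fun i j : Fin 2 => if i.val + j.val + 1 = 2 then (1 : L) else 0)).Rational ×
    (UnitaryGroup.cmDatum L 1 (Matrix.of fun i j : Fin 1 => if i.val + j.val + 1 = 1 then (1 : L) else 0)).Rational)

/-- `γ₂((γ_H)_v) = u ⊗ 1` for the global `u = (γ_H.2)₀₀ ∈ L`. [cite: Rogawski1990, §4.9 p. 55] -/
theorem finGammaTwo_rationalComponent :
    finGammaTwo L v (rationalComponent L γH v) = algebraMap L (UnitaryGroup.LocalRing L v) ((γH.2.val.val : Matrix (Fin 1) (Fin 1) L) 0 0) := by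
  unfold finGammaTwo rationalComponent
  rw [coe_coe_toLocal_toAdelic, Matrix.map_apply]

/-- `χ_g((γ_H)_v) = χ_g.map (algebraMap …)` for the global `χ_g ∈ L[X]`. [cite: Rogawski1990, §4.9 p. 55] -/
theorem finCharpolyTwo_rationalComponent :
    finCharpolyTwo L v (rationalComponent L γH v) = ((γH.1.val.val : Matrix (Fin 2) (Fin 2) L).charpoly).map (algebraMap L (UnitaryGroup.LocalRing L v)) := by
  unfold finCharpolyTwo rationalComponent
  rw [coe_coe_toLocal_toAdelic, Matrix.charpoly_map]

/-- `det (g_v)⁻¹ = (det g⁻¹) ⊗ 1`. [cite: Rogawski1990, §4.9 p. 55] -/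
theorem finDetInvFst_rationalComponent :
    ((((rationalComponent L γH v).1.val⁻¹).val : Matrix (Fin 2) (Fin 2) (UnitaryGroup.LocalRing L v))).det =
      algebraMap L (UnitaryGroup.LocalRing L v) (((γH.1.val⁻¹).val : Matrix (Fin 2) (Fin 2) L).det) := by
  unfold rationalComponent
  rw [coe_inv_toLocal_toAdelic, det_map_ringHom]

/-- `τ_v`'s argument at `(γ_H)_v` is `(−χ_g(u)·det g⁻¹) ⊗ 1`. [cite: Rogawski1990, §4.9 p. 55] -/
theorem finTauArg_rationalComponent :
    finTauArg L v (rationalComponent L γH v) =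
      algebraMap L (UnitaryGroup.LocalRing L v)
        (-(((γH.1.val.val : Matrix (Fin 2) (Fin 2) L).charpoly).eval ((γH.2.val.val : Matrix (Fin 1) (Fin 1) L) 0 0)) *
          (((γH.1.val⁻¹).val : Matrix (Fin 2) (Fin 2) L).det)) := by
  unfold finTauArg
  rw [finCharpolyTwo_rationalComponent, finGammaTwo_rationalComponent, finDetInvFst_rationalComponent, Polynomial.eval_map,
    Polynomial.eval₂_hom, map_mul, map_neg]

/-- `τ_v((γ_H)_v) = μ_v(u ⊗ 1) · μ_v((−χ_g(u)·det g⁻¹) ⊗ 1)⁻¹` — the two Hecke values at the images of global elements. [cite: Rogawski1990, §4.9 p. 55] -/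
theorem finTau_rationalComponent (μ : HeckeCharacter L) :
    finTau L v (rationalComponent L γH v) μ =
      finHeckeValue L v μ (algebraMap L (UnitaryGroup.LocalRing L v) ((γH.2.val.val : Matrix (Fin 1) (Fin 1) L) 0 0)) *
        (finHeckeValue L v μ (algebraMap L (UnitaryGroup.LocalRing L v)
          (-(((γH.1.val.val : Matrix (Fin 2) (Fin 2) L).charpoly).eval ((γH.2.val.val : Matrix (Fin 1) (Fin 1) L) 0 0)) *
            (((γH.1.val⁻¹).val : Matrix (Fin 2) (Fin 2) L).det))))⁻¹ := by
  unfold finTau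
  rw [finGammaTwo_rationalComponent, finTauArg_rationalComponent]

/-- `D_{G∕H,v}((γ_H)_v) = √(∏_{w∣v} ‖χ_g(u)‖_w)` — the `w`-adic absolute values of the GLOBAL `χ_g(u) ∈ L`. [cite: Rogawski1990, §4.9 p. 55] -/
theorem finWeylRatio_rationalComponent :
    finWeylRatio L v (rationalComponent L γH v) =
      Real.sqrt (∏ w : UnitaryGroup.PlacesOver L v,
        ‖algebraMap L (w.1.adicCompletion L) (((γH.1.val.val : Matrix (Fin 2) (Fin 2) L).charpoly).eval ((γH.2.val.val : Matrix (Fin 1) (Fin 1) L) 0 0))‖) := by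
  unfold finWeylRatio
  rw [finCharpolyTwo_rationalComponent, finGammaTwo_rationalComponent, Polynomial.eval_map, Polynomial.eval₂_hom]
  rfl

end FinH

/-! ## §2 Finite place, the pair: the projector `P`, the column form values `x_j`, the relative position and `κ_v` -/

section FinPair

variable (H' : Matrix (Fin 3) (Fin 3) L)
  (γH : (UnitaryGroup.cmDatum L 2 (Matrix.of fun i j : Fin 2 => if i.val + j.val + 1 = 2 then (1 : L) else 0)).Rational ×
    (UnitaryGroup.cmDatum L 1 (Matrix.of fun i j : Fin 1 => if i.val + j.val + 1 = 1 then (1 : L) else 0)).Rational)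

/-- **`P_v((γ_H)_v, b) = b² − (tr g ⊗ 1)·b + (det g ⊗ 1)·1` for ANY local `b`** (rational `γ_H`, e.g. `b = γ̄_v` an adelic component: the N3∕N5 shape).
[cite: Rogawski1990, §4.9 p. 55] -/
theorem finEigenlineProjector_rationalComponent_left (b : (UnitaryGroup.cmDatum L 3 H').Local v) :
    finEigenlineProjector L v H' (rationalComponent L γH v) b =
      (b.val.val : Matrix (Fin 3) (Fin 3) (UnitaryGroup.LocalRing L v)) * b.val.val -
        algebraMap L (UnitaryGroup.LocalRing L v) (γH.1.val.val : Matrix (Fin 2) (Fin 2) L).trace • (b.val.val : Matrix (Fin 3) (Fin 3) (UnitaryGroup.LocalRing L v)) +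
        algebraMap L (UnitaryGroup.LocalRing L v) (γH.1.val.val : Matrix (Fin 2) (Fin 2) L).det • (1 : Matrix (Fin 3) (Fin 3) (UnitaryGroup.LocalRing L v)) := by
  unfold finEigenlineProjector rationalComponent
  simp only []
  rw [coe_coe_toLocal_toAdelic, trace_map_ringHom, det_map_ringHom]

/-- **`P_v((γ_H)_v, γ_v) = P.map (algebraMap …)`** for a RATIONAL `γ`, with the GLOBAL projector `P = γ² − tr g·γ + det g·1 ∈ M₃(L)`. [cite: Rogawski1990, §4.9 p. 55] -/
theorem finEigenlineProjector_rationalComponent (γ : (UnitaryGroup.cmDatum L 3 H').Rational) :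
    finEigenlineProjector L v H' (rationalComponent L γH v) ((UnitaryGroup.cmDatum L 3 H').toLocal v ((UnitaryGroup.cmDatum L 3 H').toAdelic γ)) =
      ((γ.val.val : Matrix (Fin 3) (Fin 3) L) * γ.val.val - (γH.1.val.val : Matrix (Fin 2) (Fin 2) L).trace • (γ.val.val : Matrix (Fin 3) (Fin 3) L) +
          (γH.1.val.val : Matrix (Fin 2) (Fin 2) L).det • (1 : Matrix (Fin 3) (Fin 3) L)).map (algebraMap L (UnitaryGroup.LocalRing L v)) := by
  rw [finEigenlineProjector_rationalComponent_left, coe_coe_toLocal_toAdelic, map_projector]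

/-- **`x_j((γ_H)_v, γ_v) = x_j ⊗ 1`** for the GLOBAL column form values `x_j = Σ_{i,k} c(P_{ij}) H′_{ik} P_{kj} ∈ L` of the global projector `P`. [cite: Rogawski1990, §3.5 Prop. 3.5.2 (c) p. 29; §4.9 p. 55] -/
theorem finColumnFormValue_rationalComponent (γ : (UnitaryGroup.cmDatum L 3 H').Rational) (j : Fin 3) :
    finColumnFormValue L v H' (rationalComponent L γH v) ((UnitaryGroup.cmDatum L 3 H').toLocal v ((UnitaryGroup.cmDatum L 3 H').toAdelic γ)) j =
      algebraMap L (UnitaryGroup.LocalRing L v)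
        (∑ i : Fin 3, ∑ k : Fin 3,
          IsCMField.complexConj L
              (((γ.val.val : Matrix (Fin 3) (Fin 3) L) * γ.val.val - (γH.1.val.val : Matrix (Fin 2) (Fin 2) L).trace • (γ.val.val : Matrix (Fin 3) (Fin 3) L) +
                (γH.1.val.val : Matrix (Fin 2) (Fin 2) L).det • (1 : Matrix (Fin 3) (Fin 3) L)) i j) *
            H' i k *
            ((γ.val.val : Matrix (Fin 3) (Fin 3) L) * γ.val.val - (γH.1.val.val : Matrix (Fin 2) (Fin 2) L).trace • (γ.val.val : Matrix (Fin 3) (Fin 3) L) +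
              (γH.1.val.val : Matrix (Fin 2) (Fin 2) L).det • (1 : Matrix (Fin 3) (Fin 3) L)) k j) := by
  unfold finColumnFormValue
  rw [finEigenlineProjector_rationalComponent, adelicForm_map_adeleToLocal]
  simp only [Matrix.map_apply, conjLocal_algebraMap, map_sum, map_mul]

open scoped Classical in
/-- **The relative position localises: `x_v((γ_H)_v, γ_v) = x_{j₀} ⊗ 1`** where `j₀` is the FIRST non-zero column of the GLOBAL projector `P` — the same index at
every place, because `L → ∏_{w∣v} L_w` is injective (`algebraMap_localRing_injective`) — and `x_{j₀} ∈ L` the global column form value (`0` if `P = 0`).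
[cite: Rogawski1990, §4.3 p. 43; §3.5 Prop. 3.5.2 (c) p. 29] [cite: LanglandsShelstad1987, §1] -/
theorem finRelPos_rationalComponent (γ : (UnitaryGroup.cmDatum L 3 H').Rational) :
    finRelPos L v H' (rationalComponent L γH v) ((UnitaryGroup.cmDatum L 3 H').toLocal v ((UnitaryGroup.cmDatum L 3 H').toAdelic γ)) =
      algebraMap L (UnitaryGroup.LocalRing L v)
        (if h : ∃ j : Fin 3, ∃ i : Fin 3, ((γ.val.val : Matrix (Fin 3) (Fin 3) L) * γ.val.val - (γH.1.val.val : Matrix (Fin 2) (Fin 2) L).trace • (γ.val.val : Matrix (Fin 3) (Fin 3) L) +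
              (γH.1.val.val : Matrix (Fin 2) (Fin 2) L).det • (1 : Matrix (Fin 3) (Fin 3) L)) i j ≠ 0 then
          ∑ i : Fin 3, ∑ k : Fin 3,
            IsCMField.complexConj L (((γ.val.val : Matrix (Fin 3) (Fin 3) L) * γ.val.val - (γH.1.val.val : Matrix (Fin 2) (Fin 2) L).trace • (γ.val.val : Matrix (Fin 3) (Fin 3) L) +
              (γH.1.val.val : Matrix (Fin 2) (Fin 2) L).det • (1 : Matrix (Fin 3) (Fin 3) L)) i (Fin.find (fun j : Fin 3 => ∃ i : Fin 3, ((γ.val.val : Matrix (Fin 3) (Fin 3) L) * γ.val.val - (γH.1.val.val : Matrix (Fin 2) (Fin 2) L).trace • (γ.val.val : Matrix (Fin 3) (Fin 3) L) +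
              (γH.1.val.val : Matrix (Fin 2) (Fin 2) L).det • (1 : Matrix (Fin 3) (Fin 3) L)) i j ≠ 0) h)) * H' i k *
              ((γ.val.val : Matrix (Fin 3) (Fin 3) L) * γ.val.val - (γH.1.val.val : Matrix (Fin 2) (Fin 2) L).trace • (γ.val.val : Matrix (Fin 3) (Fin 3) L) +
              (γH.1.val.val : Matrix (Fin 2) (Fin 2) L).det • (1 : Matrix (Fin 3) (Fin 3) L)) k (Fin.find (fun j : Fin 3 => ∃ i : Fin 3, ((γ.val.val : Matrix (Fin 3) (Fin 3) L) * γ.val.val - (γH.1.val.val : Matrix (Fin 2) (Fin 2) L).trace • (γ.val.val : Matrix (Fin 3) (Fin 3) L) +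
              (γH.1.val.val : Matrix (Fin 2) (Fin 2) L).det • (1 : Matrix (Fin 3) (Fin 3) L)) i j ≠ 0) h)
        else 0) := by
  have hinj := algebraMap_localRing_injective L v
  have hP := finEigenlineProjector_rationalComponent L v H' γH γ
  have key : ∀ j : Fin 3,
      (∃ i : Fin 3, finEigenlineProjector L v H' (rationalComponent L γH v)
          ((UnitaryGroup.cmDatum L 3 H').toLocal v ((UnitaryGroup.cmDatum L 3 H').toAdelic γ)) i j ≠ 0) ↔
        (∃ i : Fin 3, ((γ.val.val : Matrix (Fin 3) (Fin 3) L) * γ.val.val - (γH.1.val.val : Matrix (Fin 2) (Fin 2) L).trace • (γ.val.val : Matrix (Fin 3) (Fin 3) L) +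
              (γH.1.val.val : Matrix (Fin 2) (Fin 2) L).det • (1 : Matrix (Fin 3) (Fin 3) L)) i j ≠ 0) := by
    intro j
    simp only [hP, Matrix.map_apply, map_ne_zero_iff _ hinj]
  unfold finRelPos
  by_cases h : ∃ j : Fin 3, ∃ i : Fin 3, ((γ.val.val : Matrix (Fin 3) (Fin 3) L) * γ.val.val - (γH.1.val.val : Matrix (Fin 2) (Fin 2) L).trace • (γ.val.val : Matrix (Fin 3) (Fin 3) L) +
              (γH.1.val.val : Matrix (Fin 2) (Fin 2) L).det • (1 : Matrix (Fin 3) (Fin 3) L)) i j ≠ 0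
  · have h' : ∃ j : Fin 3, ∃ i : Fin 3, finEigenlineProjector L v H' (rationalComponent L γH v)
        ((UnitaryGroup.cmDatum L 3 H').toLocal v ((UnitaryGroup.cmDatum L 3 H').toAdelic γ)) i j ≠ 0 := by
      obtain ⟨j, hj⟩ := h
      exact ⟨j, (key j).2 hj⟩
    rw [dif_pos h', dif_pos h, finColumnFormValue_rationalComponent, Fin.find_congr' (fun {j} => key j)]
  · have h' : ¬ ∃ j : Fin 3, ∃ i : Fin 3, finEigenlineProjector L v H' (rationalComponent L γH v)
        ((UnitaryGroup.cmDatum L 3 H').toLocal v ((UnitaryGroup.cmDatum L 3 H').toAdelic γ)) i j ≠ 0 := by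
      rintro ⟨j, hj⟩
      exact h ⟨j, (key j).1 hj⟩
    rw [dif_neg h', dif_neg h, map_zero]

open scoped Classical in
/-- **`κ_v` localises: `κ_v((γ_H)_v, γ_v)` reads ONLY the global projector `P` (zero or not), the splitting type of `v`, and — at a non-split `v` — the norm class in
`L_w` of the GLOBAL relative position `x_{j₀} ⊗ 1`** (the `d`-free Hilbert symbol `(x_{j₀}, d)_v`).  This is the shape Hilbert reciprocity is applied to in N4∕N5.
[cite: Rogawski1990, §14.6 p. 242; §4.3 p. 43] [cite: LanglandsShelstad1987, §6.3–6.4] -/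
theorem finKappaAt_rationalComponent (γ : (UnitaryGroup.cmDatum L 3 H').Rational) :
    finKappaAt L v H' (rationalComponent L γH v) ((UnitaryGroup.cmDatum L 3 H').toLocal v ((UnitaryGroup.cmDatum L 3 H').toAdelic γ)) =
      if ((γ.val.val : Matrix (Fin 3) (Fin 3) L) * γ.val.val - (γH.1.val.val : Matrix (Fin 2) (Fin 2) L).trace • (γ.val.val : Matrix (Fin 3) (Fin 3) L) +
              (γH.1.val.val : Matrix (Fin 2) (Fin 2) L).det • (1 : Matrix (Fin 3) (Fin 3) L)) = 0 then 0
      else if ¬ Subsingleton (UnitaryGroup.PlacesOver L v) then 1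
      else if ∃ z : UnitaryGroup.LocalRing L v, IsUnit z ∧
          algebraMap L (UnitaryGroup.LocalRing L v)
              (if h : ∃ j : Fin 3, ∃ i : Fin 3, ((γ.val.val : Matrix (Fin 3) (Fin 3) L) * γ.val.val - (γH.1.val.val : Matrix (Fin 2) (Fin 2) L).trace • (γ.val.val : Matrix (Fin 3) (Fin 3) L) +
              (γH.1.val.val : Matrix (Fin 2) (Fin 2) L).det • (1 : Matrix (Fin 3) (Fin 3) L)) i j ≠ 0 then
                ∑ i : Fin 3, ∑ k : Fin 3,
                  IsCMField.complexConj L (((γ.val.val : Matrix (Fin 3) (Fin 3) L) * γ.val.val - (γH.1.val.val : Matrix (Fin 2) (Fin 2) L).trace • (γ.val.val : Matrix (Fin 3) (Fin 3) L) +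
              (γH.1.val.val : Matrix (Fin 2) (Fin 2) L).det • (1 : Matrix (Fin 3) (Fin 3) L)) i (Fin.find (fun j : Fin 3 => ∃ i : Fin 3, ((γ.val.val : Matrix (Fin 3) (Fin 3) L) * γ.val.val - (γH.1.val.val : Matrix (Fin 2) (Fin 2) L).trace • (γ.val.val : Matrix (Fin 3) (Fin 3) L) +
              (γH.1.val.val : Matrix (Fin 2) (Fin 2) L).det • (1 : Matrix (Fin 3) (Fin 3) L)) i j ≠ 0) h)) * H' i k *
                    ((γ.val.val : Matrix (Fin 3) (Fin 3) L) * γ.val.val - (γH.1.val.val : Matrix (Fin 2) (Fin 2) L).trace • (γ.val.val : Matrix (Fin 3) (Fin 3) L) +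
              (γH.1.val.val : Matrix (Fin 2) (Fin 2) L).det • (1 : Matrix (Fin 3) (Fin 3) L)) k (Fin.find (fun j : Fin 3 => ∃ i : Fin 3, ((γ.val.val : Matrix (Fin 3) (Fin 3) L) * γ.val.val - (γH.1.val.val : Matrix (Fin 2) (Fin 2) L).trace • (γ.val.val : Matrix (Fin 3) (Fin 3) L) +
              (γH.1.val.val : Matrix (Fin 2) (Fin 2) L).det • (1 : Matrix (Fin 3) (Fin 3) L)) i j ≠ 0) h)
              else 0) =
            z * UnitaryGroup.conjLocal L (IsCMField.complexConj L) v z then 1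
      else -1 := by
  have hinj := algebraMap_localRing_injective L v
  have hP := finEigenlineProjector_rationalComponent L v H' γH γ
  have hzero : (finEigenlineProjector L v H' (rationalComponent L γH v)
        ((UnitaryGroup.cmDatum L 3 H').toLocal v ((UnitaryGroup.cmDatum L 3 H').toAdelic γ)) = 0) ↔ ((γ.val.val : Matrix (Fin 3) (Fin 3) L) * γ.val.val - (γH.1.val.val : Matrix (Fin 2) (Fin 2) L).trace • (γ.val.val : Matrix (Fin 3) (Fin 3) L) +
              (γH.1.val.val : Matrix (Fin 2) (Fin 2) L).det • (1 : Matrix (Fin 3) (Fin 3) L)) = 0 := by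
    rw [hP, ← Matrix.map_zero (algebraMap L (UnitaryGroup.LocalRing L v)) (map_zero _)]
    exact (Matrix.map_injective hinj).eq_iff
  unfold finKappaAt
  rw [finRelPos_rationalComponent]
  simp only [hzero]

end FinPair

/-! ## §3 Archimedean place, rational pair: `u`, `χ_g`, `τ_∞`, `D_{G∕H,∞}`, `P_w` are images of the same global elements -/

section Arch

variable (H' : Matrix (Fin 3) (Fin 3) L)
  (γH : (UnitaryGroup.cmDatum L 2 (Matrix.of fun i j : Fin 2 => if i.val + j.val + 1 = 2 then (1 : L) else 0)).Rational ×
    (UnitaryGroup.cmDatum L 1 (Matrix.of fun i j : Fin 1 => if i.val + j.val + 1 = 1 then (1 : L) else 0)).Rational)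

omit [NumberField L] [IsCMField L] in
/-- The `w`-coordinate of a matrix pushed along `mixedEmbedding` is its image under `σ_w` (bookkeeping, Mathlib `mixedEmbedding_apply_isComplex`: `L ⊗ ℝ = ∏_w L_w`). [cite: CasselsFrohlichANT1967, Ch. II §10–§11] [cite: BorelJacquet1979, §4.1] -/
theorem map_mixedEmbedding_map_evalC {m n : ℕ} (M : Matrix (Fin m) (Fin n) L) (w : {w : InfinitePlace L // InfinitePlace.IsComplex w}) :
    (M.map (mixedEmbedding L)).map (UnitaryGroup.evalC L w) = M.map w.1.embedding := by
  ext i j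
  exact mixedEmbedding.mixedEmbedding_apply_isComplex L (M i j) w

/-- `γ₂(γ_H ⊗ 1) = u ⊗ 1 ∈ L ⊗ ℝ`. [cite: Rogawski1990, §4.9 p. 55] -/
theorem archGammaTwo_rationalArch :
    archGammaTwo L (rationalArch L γH) = mixedEmbedding L ((γH.2.val.val : Matrix (Fin 1) (Fin 1) L) 0 0) := by
  unfold archGammaTwo rationalArch
  simp only []
  rw [coe_coe_cmRationalToArch, Matrix.map_apply]

/-- `χ_g(γ_H ⊗ 1) = χ_g.map (mixedEmbedding L)`. [cite: Rogawski1990, §4.9 p. 55] -/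
theorem archCharpolyTwo_rationalArch :
    archCharpolyTwo L (rationalArch L γH) = ((γH.1.val.val : Matrix (Fin 2) (Fin 2) L).charpoly).map (mixedEmbedding L) := by
  unfold archCharpolyTwo rationalArch
  simp only []
  rw [coe_coe_cmRationalToArch, Matrix.charpoly_map]

/-- `τ`'s argument at `γ_H ⊗ 1` is `(−χ_g(u)·det g⁻¹) ⊗ 1`. [cite: Rogawski1990, §4.9 p. 55] -/
theorem archTauArg_rationalArch :
    archTauArg L (rationalArch L γH) =
      mixedEmbedding L
        (-(((γH.1.val.val : Matrix (Fin 2) (Fin 2) L).charpoly).eval ((γH.2.val.val : Matrix (Fin 1) (Fin 1) L) 0 0)) *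
          (((γH.1.val⁻¹).val : Matrix (Fin 2) (Fin 2) L).det)) := by
  unfold archTauArg
  rw [archCharpolyTwo_rationalArch, archGammaTwo_rationalArch, Polynomial.eval_map, Polynomial.eval₂_hom]
  have hdet : ((((rationalArch L γH).1 : GL (Fin 2) (mixedEmbedding.mixedSpace L))⁻¹ : GL (Fin 2) (mixedEmbedding.mixedSpace L)) :
        Matrix (Fin 2) (Fin 2) (mixedEmbedding.mixedSpace L)).det =
      mixedEmbedding L (((γH.1.val⁻¹).val : Matrix (Fin 2) (Fin 2) L).det) := by
    unfold rationalArch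
    simp only []
    rw [coe_inv_cmRationalToArch, det_map_ringHom]
  rw [hdet, map_mul, map_neg]

/-- `τ_∞(γ_H ⊗ 1) = μ_∞(u ⊗ 1) · μ_∞((−χ_g(u)·det g⁻¹) ⊗ 1)⁻¹`. [cite: Rogawski1990, §4.9 p. 55] -/
theorem archTau_rationalArch (μ : HeckeCharacter L) :
    archTau L (rationalArch L γH) μ =
      archHeckeValue L μ (mixedEmbedding L ((γH.2.val.val : Matrix (Fin 1) (Fin 1) L) 0 0)) *
        (archHeckeValue L μ (mixedEmbedding L
          (-(((γH.1.val.val : Matrix (Fin 2) (Fin 2) L).charpoly).eval ((γH.2.val.val : Matrix (Fin 1) (Fin 1) L) 0 0)) *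
            (((γH.1.val⁻¹).val : Matrix (Fin 2) (Fin 2) L).det))))⁻¹ := by
  unfold archTau
  rw [archGammaTwo_rationalArch, archTauArg_rationalArch]

open scoped Classical in
/-- `D_{G∕H,∞}(γ_H ⊗ 1) = ∏_{w complex} ‖σ_w(χ_g(u))‖` — the complex embeddings of the GLOBAL `χ_g(u)`. [cite: Rogawski1990, §4.9 p. 55] -/
theorem archWeylRatio_rationalArch :
    archWeylRatio L (rationalArch L γH) =
      ∏ w : {w : InfinitePlace L // InfinitePlace.IsComplex w},
        ‖w.1.embedding (((γH.1.val.val : Matrix (Fin 2) (Fin 2) L).charpoly).eval ((γH.2.val.val : Matrix (Fin 1) (Fin 1) L) 0 0))‖ := by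
  unfold archWeylRatio
  rw [archCharpolyTwo_rationalArch, archGammaTwo_rationalArch, Polynomial.eval_map, Polynomial.eval₂_hom]
  refine Finset.prod_congr rfl fun w _ => ?_
  rw [UnitaryGroup.evalC_apply, mixedEmbedding.mixedEmbedding_apply_isComplex]

/-- **`P_w(γ_H ⊗ 1, γ ⊗ 1) = σ_w(P)`** for the GLOBAL projector `P = γ² − tr g·γ + det g·1 ∈ M₃(L)` at a rational pair. [cite: Rogawski1990, §4.9 p. 55; §14.6 p. 242] -/
theorem archEigenlineProjector_rationalArch (w : {w : InfinitePlace L // InfinitePlace.IsComplex w}) (γ : (UnitaryGroup.cmDatum L 3 H').Rational) :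
    archEigenlineProjector L H' (rationalArch L γH) w (cmRationalToArch L 3 H' γ) =
      ((γ.val.val : Matrix (Fin 3) (Fin 3) L) * γ.val.val - (γH.1.val.val : Matrix (Fin 2) (Fin 2) L).trace • (γ.val.val : Matrix (Fin 3) (Fin 3) L) +
          (γH.1.val.val : Matrix (Fin 2) (Fin 2) L).det • (1 : Matrix (Fin 3) (Fin 3) L)).map w.1.embedding := by
  unfold archEigenlineProjector rationalArch
  simp only []
  rw [coe_coe_cmRationalToArch, coe_coe_cmRationalToArch, map_mixedEmbedding_map_evalC, map_mixedEmbedding_map_evalC,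
    trace_map_ringHom, det_map_ringHom, map_projector]

/-- **`κ_w(γ_H ⊗ 1, γ ⊗ 1) = sgn Re tr(σ_w(P)ᴴ · σ_w(H′) · σ_w(P)) · η_w(H′)`** — the archimedean sign at a rational pair reads only the GLOBAL projector `P`.
[cite: Rogawski1990, §14.6 p. 242] [cite: LanglandsShelstad1987, §6.3–6.4] -/
theorem archKappaAt_rationalArch (w : {w : InfinitePlace L // InfinitePlace.IsComplex w}) (γ : (UnitaryGroup.cmDatum L 3 H').Rational) :
    archKappaAt L H' (rationalArch L γH) w (cmRationalToArch L 3 H' γ) =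
      (SignType.sign ((Matrix.trace ((((γ.val.val : Matrix (Fin 3) (Fin 3) L) * γ.val.val - (γH.1.val.val : Matrix (Fin 2) (Fin 2) L).trace • (γ.val.val : Matrix (Fin 3) (Fin 3) L) +
          (γH.1.val.val : Matrix (Fin 2) (Fin 2) L).det • (1 : Matrix (Fin 3) (Fin 3) L)).map w.1.embedding)ᴴ * H'.map w.1.embedding * ((γ.val.val : Matrix (Fin 3) (Fin 3) L) * γ.val.val - (γH.1.val.val : Matrix (Fin 2) (Fin 2) L).trace • (γ.val.val : Matrix (Fin 3) (Fin 3) L) +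
          (γH.1.val.val : Matrix (Fin 2) (Fin 2) L).det • (1 : Matrix (Fin 3) (Fin 3) L)).map w.1.embedding)).re) : ℤ) *
        archMajoritySign L H' w := by
  unfold archKappaAt
  rw [archEigenlineProjector_rationalArch]

end Arch

end Literature.NumberTheory.Rogawski1990

end
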